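import Literature.NumberTheory.GaloisRepresentations.SerreWeight
import Literature.NumberTheory.GaloisRepresentations.ModPGaloisRepProofs
import Literature.NumberTheory.GaloisRepresentations.ModPGaloisRepKummerProofs
import HarnessLib

/-!
# Discharge of `serreWeightLocal_eq_residueFieldCard_add_one` of `SerreWeight.lean`: the weight is `q + 1` in the très ramifiée case (trunk GalRep, item C16)

D-0014 keeps `Literature/` sorry-free by stating cited results as named facts `def X : Prop`.
This sibling file of `Literature.NumberTheory.GaloisRepresentations.SerreWeight` (next to
`SerreWeightProofs.lean`, the peu ramifiée case `k = 2`) proves, as `theorem X_holds : X`,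

* `Literature.ModPGaloisRep.serreWeightLocal_eq_residueFieldCard_add_one_holds :
  ρ.serreWeightLocal_eq_residueFieldCard_add_one ι` — for `k` discrete, `ι` injective,
  `q = residueFieldCard F ≠ 2`, `ρ̄_F` très ramifiée with `ρ̄|I_F ≃ (χ *; 0 1)`
  (`HasLevelOneInertiaShape ι ϖ hϖ 1 0`), Serre's weight is `k(ρ̄_F) = q + 1`,

together with the two ingredients of independent interest

* `Literature.NumberTheory.GaloisRepresentations.ModPGaloisRep.HasLevelOneInertiaShape.exponent_eq_one` — uniqueness of the exponent on
  the stable line: shapes `(χ *; 0 1)` and `(χ'^β *; 0 1)` with `1 ≤ β ≤ q - 1` force `β = 1`;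
* `Literature.NumberTheory.GaloisRepresentations.ModPGaloisRep.serreWeightLocal_eq_residueFieldCard_add_one_of_unique` — the cheap
  reduction of the fact to the named fact `IsSerreWeight.unique` (not used by the discharge).

## The printed statement

Serre, Duke Math. J. 54 (1987), §2.4 (ii) (`β = α + 1`): if `ρ_p|I` is très ramifiée one sets
`k = 1 + pa + b + p - 1 = (α + 1)(p + 1)` for `p ≠ 2` ((2.4.9), with `a = min(α, β) = α`,
`b = β`); for `α = 0`, `β = 1` this is `k = p + 1`.  Serre restates it in §2.7, Remarque (1)
(`p ≠ 2`): "On a `k = p + 1` si et seulement si `ρ_p|I` est de la forme `(χ *; 0 1)` et est très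
ramifiée."  The named fact is the "if" direction, with `q = residueFieldCard F` for `p` (read in
Serre, *Œuvres* IV, no. 143, §2.4 and §2.7).

## Proof

`serreWeightLocal ρ ι` is defined by cases (level two / tame / wild), each an `sInf`.
(1) `ρ̄` is not tame (`IsTresRamifie.not_isTamelyRamified`).  (2) No level-two weight exists: a
level-two inertia shape forces tameness (`HasLevelTwoInertiaShape.isTamelyRamified_holds`, file
`ModPGaloisRepProofs`: the fundamental characters are characters of the tame inertia, Serre §2.1,
Prop. 1).  (3) Hence `serreWeightLocal ρ ι = sInf {m | IsLevelOneWildWeight m}`, and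
`q + 1 = (0 + 1)(q + 1)` is such a weight (`isLevelOneWildWeight_residueFieldCard_add_one`).
(4) Minimality: any admissible normalisation `(α', β', ϖ')` of a level-one shape of `ρ̄` gives a
weight `≥ q + 1` — if `α' ≥ 1` then `m ≥ 1 + q`; if `β' = α' + 1` (très ramifiée) then
`m = (α' + 1)(q + 1) ≥ q + 1`; the remaining case `α' = 0`, `β' ≠ 1`, `m = 1 + β' ≤ q` is excluded
by the **uniqueness of the exponent on the stable line** (`exponent_eq_one`; Serre §2.4, (2.4.2):
`ρ_p|I = (χ^β *; 0 χ^α)` with `α, β ∈ ℤ/(p-1)ℤ`, and "On normalise les exposants `α` et `β` par: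
(2.4.3) `0 ≤ α ≤ p-2` et `1 ≤ β ≤ p-1`"): comparing determinants of the two shapes gives `χ(τ) ^ β' = χ(τ)` on
`I_F` (`χ = ψ_1`, independent of the uniformiser by `fundamentalCharacter_eq_holds`), and `χ`
takes the value `ζ mod 𝔓` for a primitive `(q-1)`-th root of unity `ζ`
(`exists_fundamentalCharacter_apply_eq`: surjectivity of the Kummer character `θ_{q-1}`, Serre,
Invent. Math. 15 (1972), §1.3 — file `ModPGaloisRepKummerProofs`), whose reduction has exact
order `q - 1` (`eq_one_of_pow_eq_one_of_sub_one_mem_absMaximalIdeal`); so `q - 1 ∣ β' - 1 < q - 1`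
and `β' = 1`.

Only Mathlib and proved results of `Literature/` are used (the chain
`InertiaRootsOfUnity` → `UnramifiedKummer` → `ModPGaloisRepKummerProofs` supplies the
surjectivity of `θ_d`, `ModPGaloisRepProofs` its tameness).

## References

* [Serre1987] J.-P. Serre, *Sur les représentations modulaires de degré 2 de `Gal(ℚ̄/ℚ)`*, Duke
  Math. J. 54 (1987), 179–230, §2.1 (Prop. 1), §2.4 ((2.4.2)–(2.4.3), (ii₂), (2.4.9)), §2.7
  Remarque (1).
* [SerreInventiones1972] J.-P. Serre, *Propriétés galoisiennes des points d'ordre fini des courbes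
  elliptiques*, Invent. Math. 15 (1972), §1.3 (Prop. 1–2), §1.7.
-/

noncomputable section

open scoped Valued
open Field ValuativeRel

namespace Literature.NumberTheory.GaloisRepresentations
namespace ModPGaloisRep

open GaloisRepresentations.IsNonarchimedeanLocalField

universe u v

section SerreWeightLocal

variable {F : Type u} [Field F] [ValuativeRel F] [TopologicalSpace F] [IsNonarchimedeanLocalField F]
variable {k : Type v} [Field k] [TopologicalSpace k]
variable (ρ : ModPGaloisRep F k 2) (ι : absIntegers 𝒪[F] F ⧸ absMaximalIdeal F →+* k)

/-- In the très ramifiée case with `ρ̄|I_F ≃ (χ *; 0 1)` (`α = 0`, `β = 1`) and `q ≠ 2`, the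
number `q + 1 = (α + 1)(q + 1)` is a level-one wild weight of `ρ̄_F` (case (ii₂) of Serre's
recipe).  Ref: Serre, Duke Math. J. 54 (1987), §2.4, (2.4.9). [cite: Serre1987, §2.4 (ii₂)] -/
theorem isLevelOneWildWeight_residueFieldCard_add_one (hq : residueFieldCard F ≠ 2)
    (htres : ρ.IsTresRamifie) {ϖ : 𝒪[F]} (hϖ : Irreducible ϖ)
    (h : ρ.HasLevelOneInertiaShape ι ϖ hϖ 1 0) :
    ρ.IsLevelOneWildWeight ι (residueFieldCard F + 1) := by
  classical
  have h2 := one_lt_residueFieldCard F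
  refine ⟨htres.not_isTamelyRamified, 0, 1, by omega, le_rfl, by omega, ⟨ϖ, hϖ, h⟩, ?_⟩
  rw [if_pos ⟨rfl, htres⟩, if_neg hq]
  ring

/-- **`serreWeightLocal_eq_residueFieldCard_add_one` from the uniqueness of the weight**: if
Serre weights of `ρ̄_F` are unique (named fact `IsSerreWeight.unique`), then in the très ramifiée
case `ρ̄|I_F ≃ (χ *; 0 1)`, `q ≠ 2`, `k(ρ̄_F) = q + 1`, both `serreWeightLocal`
(`isSerreWeight_serreWeightLocal_of`) and `q + 1` being Serre weights.  (A cheap alternative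
route; the discharge below does not use it.)
Ref: Serre, Duke Math. J. 54 (1987), §2.4 (ii₂) and §2.7, Remarque (1). [cite: Serre1987, §2.4 (ii₂)] -/
theorem serreWeightLocal_eq_residueFieldCard_add_one_of_unique (hU : IsSerreWeight.unique ρ ι) :
    serreWeightLocal_eq_residueFieldCard_add_one ρ ι := by
  intro _ hι hq htres ϖ hϖ h
  have hw := isLevelOneWildWeight_residueFieldCard_add_one ρ ι hq htres hϖ h
  have hex : ρ.exists_isSerreWeight ι := by
    intro _
    exact ⟨_, hw.isSerreWeight⟩
  exact hU hι (isSerreWeight_serreWeightLocal_of ρ ι hex) hw.isSerreWeight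

variable {ρ ι}

/-- **Uniqueness of the exponent `β` on the stable line**: if `ρ̄|I_F ≃ (χ *; 0 1)` and also
`ρ̄|I_F ≃ (χ'^β *; 0 1)` with `1 ≤ β ≤ q - 1` (`χ, χ'` the level-one fundamental characters for
two uniformisers, equal by `fundamentalCharacter_eq_holds`; `ι` injective), then `β = 1`.
Proof: comparing determinants, `χ(τ)^β = χ(τ)` for all `τ ∈ I_F`; choosing `τ` with
`χ(τ) = ι(ζ mod 𝔓)`, `ζ ∈ F̄` a primitive `(q-1)`-th root of unity
(`exists_fundamentalCharacter_apply_eq`), gives `ζ^(β-1) ≡ 1 (mod 𝔓)`, hence `ζ^(β-1) = 1`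
(roots of unity of order prime to `p` are distinct mod `𝔓`) and `q - 1 ∣ β - 1 < q - 1`.
Ref: Serre, Duke Math. J. 54 (1987), §2.4 ((2.4.2)–(2.4.3): `α, β` unique in `ℤ/(p-1)ℤ`,
normalised by `1 ≤ β ≤ p - 1`); Serre, Invent. Math. 15 (1972), §1.3, Prop. 1–2, §1.7.
[cite: Serre1987, §2.4 (2.4.2)–(2.4.3)] -/
theorem HasLevelOneInertiaShape.exponent_eq_one
    (hι : Function.Injective ι) {ϖ ϖ' : 𝒪[F]} (hϖ : Irreducible ϖ) (hϖ' : Irreducible ϖ')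
    {β : ℕ} (h1 : ρ.HasLevelOneInertiaShape ι ϖ hϖ 1 0)
    (hβ : ρ.HasLevelOneInertiaShape ι ϖ' hϖ' β 0) (hβ1 : 1 ≤ β)
    (hβq : β + 1 ≤ residueFieldCard F) : β = 1 := by
  -- Step 1: comparing determinants, `χ(τ) ^ β = χ(τ)` for all `τ ∈ I_F`
  have hχ' : fundamentalCharacter F 1 ι ϖ' hϖ' = fundamentalCharacter F 1 ι ϖ hϖ :=
    fundamentalCharacter_eq_holds F 1 ι ϖ' ϖ hϖ' hϖ
  obtain ⟨P, hP⟩ := h1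
  obtain ⟨Q, hQ⟩ := hβ
  have hconj : ∀ (R : GL (Fin 2) k) (τ : absInertia F),
      Matrix.det ((R * ρ (τ : absoluteGaloisGroup F) * R⁻¹ : GL (Fin 2) k) :
        Matrix (Fin 2) (Fin 2) k) =
      Matrix.det ((ρ (τ : absoluteGaloisGroup F) : GL (Fin 2) k) : Matrix (Fin 2) (Fin 2) k) := by
    intro R τ
    rw [← Matrix.GeneralLinearGroup.val_det_apply, map_mul, map_mul, map_inv,
      mul_inv_cancel_comm, Matrix.GeneralLinearGroup.val_det_apply]
  have hdet : ∀ τ : absInertia F,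
      ((fundamentalCharacter F 1 ι ϖ hϖ τ ^ β : kˣ) : k) =
        (fundamentalCharacter F 1 ι ϖ hϖ τ : k) := by
    intro τ
    obtain ⟨c, hc⟩ := hP τ
    obtain ⟨c', hc'⟩ := hQ τ
    rw [hχ'] at hc'
    have hd1 := congrArg Matrix.det hc
    have hd2 := congrArg Matrix.det hc'
    rw [Matrix.det_fin_two_of, hconj] at hd1 hd2
    simp only [pow_zero, pow_one, Units.val_one, mul_one, mul_zero, sub_zero] at hd1 hd2
    rw [← hd2]
    exact hd1
  -- Step 2: a primitive root of unity `ζ ∈ F̄` of order `N = q - 1`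
  set N : ℕ := residueFieldCard F ^ 1 - 1 with hN
  have hN' : N = residueFieldCard F - 1 := by rw [hN, pow_one]
  have hNpos : 0 < N := residueFieldCard_pow_sub_one_pos F one_ne_zero
  haveI : NeZero ((N : ℕ) : AlgebraicClosure F) := ⟨by
    have hu := (isUnit_natCast_residueFieldCard_pow_sub_one F one_ne_zero).map
      (algebraMap 𝒪[F] (AlgebraicClosure F))
    rw [map_natCast] at hu
    exact hu.ne_zero⟩
  obtain ⟨ζ, hζ⟩ := HasEnoughRootsOfUnity.exists_primitiveRoot (AlgebraicClosure F) N
  -- Step 3: `τ ∈ I_F` with `χ(τ) = ι(ζ mod 𝔓)` (surjectivity of the Kummer character)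
  obtain ⟨τ, Z, hZ, hτ⟩ :=
    exists_fundamentalCharacter_apply_eq F one_ne_zero ι ϖ hϖ ζ hζ.pow_eq_one
  have hZN : Z ^ N = 1 := Subtype.ext (by simp [hZ, hζ.pow_eq_one])
  -- Step 4: in `S ⧸ 𝔓`, `x = ζ mod 𝔓` satisfies `x ^ β = x` and `x ^ N = 1`, so `x ^ (β-1) = 1`
  have hx : ι (Ideal.Quotient.mk _ Z ^ β) = ι (Ideal.Quotient.mk _ Z) := by
    have := hdet τ
    rwa [Units.val_pow_eq_pow_val, hτ, ← map_pow] at this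
  have hx' := hι hx
  set x := Ideal.Quotient.mk (absMaximalIdeal F) Z with hxdef
  have hxN : x ^ N = 1 := by rw [hxdef, ← map_pow, hZN, map_one]
  have hxu : IsUnit x := IsUnit.of_pow_eq_one hxN hNpos.ne'
  have hxb : x ^ (β - 1) = 1 := by
    refine hxu.mul_left_cancel ?_
    rw [mul_one, ← pow_succ', Nat.sub_add_cancel hβ1]
    exact hx'
  -- Step 5: lift to `S`: `Z ^ (β-1) ≡ 1 (mod 𝔓)` forces `Z ^ (β-1) = 1`, i.e. `ζ ^ (β-1) = 1`
  have hmem : Z ^ (β - 1) - 1 ∈ absMaximalIdeal F := by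
    rw [← Ideal.Quotient.eq, map_pow, map_one]
    exact hxb
  have hZb : Z ^ (β - 1) = 1 :=
    eq_one_of_pow_eq_one_of_sub_one_mem_absMaximalIdeal
      (isUnit_natCast_residueFieldCard_pow_sub_one F one_ne_zero)
      (by rw [← pow_mul, mul_comm, pow_mul, hZN, one_pow]) hmem
  have hζb : ζ ^ (β - 1) = 1 := by
    have := congrArg (fun y : absIntegers 𝒪[F] F => (y : AlgebraicClosure F)) hZb
    simpa [hZ] using this
  -- Step 6: `N ∣ β - 1 < N`
  have hdvd : N ∣ β - 1 := hζ.dvd_of_pow_eq_one _ hζb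
  have hlt : β - 1 < N := by
    rw [hN']
    have := one_lt_residueFieldCard F
    omega
  have h0 := Nat.eq_zero_of_dvd_of_lt hdvd hlt
  omega

variable (ρ ι)

/-- **Discharge of `ModPGaloisRep.serreWeightLocal_eq_residueFieldCard_add_one`**: Serre's weight
of a très ramifiée `ρ̄_F` with `ρ̄|I_F ≃ (χ *; 0 1)` and `q ≠ 2` is `q + 1`.  `ρ̄` is wild
(`IsTresRamifie.not_isTamelyRamified`), not of level two
(`HasLevelTwoInertiaShape.isTamelyRamified_holds`), `q + 1` is a level-one wild weight, and every
other admissible normalisation `(α', β')` of a level-one shape of `ρ̄` yields a weight `≥ q + 1`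
(`α' ≥ 1`, or `β' = α' + 1` très ramifiée), the case `α' = 0`, `β' ≠ 1` being excluded by
`HasLevelOneInertiaShape.exponent_eq_one`.
Ref: Serre, Duke Math. J. 54 (1987), §2.4 (ii₂), (2.4.9) (`k = 1 + pa + b + p - 1`), and §2.7,
Remarque (1) ("On a `k = p + 1` si et seulement si `ρ_p|I` est de la forme `(χ *; 0 1)` et est
très ramifiée", `p ≠ 2`). [cite: Serre1987, §2.4 (ii₂) and §2.7 Remarque (1)] -/
theorem serreWeightLocal_eq_residueFieldCard_add_one_holds :
    serreWeightLocal_eq_residueFieldCard_add_one ρ ι := by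
  intro _ hι hq htres ϖ hϖ h
  classical
  have hw := isLevelOneWildWeight_residueFieldCard_add_one ρ ι hq htres hϖ h
  have hnt : ¬ ρ.IsTamelyRamified := htres.not_isTamelyRamified
  have h2 : ¬ ∃ m, ρ.IsLevelTwoWeight ι m := fun ⟨m, hm⟩ =>
    hnt (IsLevelTwoWeight.isTamelyRamified_of
      HasLevelTwoInertiaShape.isTamelyRamified_holds hm)
  rw [serreWeightLocal, if_neg h2, if_neg hnt]
  refine le_antisymm (Nat.sInf_le hw) (le_csInf ⟨_, hw⟩ ?_)
  rintro m ⟨-, α, β, hα, hβ1, hβq, ⟨ϖ', hϖ', hshape⟩, rfl⟩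
  have hq2 := one_lt_residueFieldCard F
  by_cases hc : β = α + 1 ∧ ρ.IsTresRamifie
  · rw [if_pos hc, if_neg hq]
    exact Nat.le_mul_of_pos_left _ (Nat.succ_pos α)
  · rw [if_neg hc]
    rcases Nat.eq_zero_or_pos α with hα0 | hαpos
    · subst hα0
      have hβne : β ≠ 1 := fun hβe => hc ⟨by omega, htres⟩
      exact absurd (HasLevelOneInertiaShape.exponent_eq_one hι hϖ hϖ' h hshape hβ1 hβq) hβne
    · have hmin : 1 ≤ min α β := le_min hαpos hβ1
      have hmax : 1 ≤ max α β := le_trans hβ1 (le_max_right _ _)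
      have hmul : residueFieldCard F * 1 ≤ residueFieldCard F * min α β :=
        Nat.mul_le_mul_left _ hmin
      rw [mul_one] at hmul
      calc residueFieldCard F + 1 ≤ residueFieldCard F * min α β + max α β := add_le_add hmul hmax
        _ ≤ 1 + residueFieldCard F * min α β + max α β := by
          rw [add_assoc]; exact Nat.le_add_left _ _

end SerreWeightLocal

end ModPGaloisRep
end Literature.NumberTheory.GaloisRepresentations
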